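import Mathlib
import Literature.Combinatorics.Optimization.KnapsackPseudoDensity
import Literature.Combinatorics.Optimization.SosPseudoDensityDuality
import Literature.Combinatorics.AssociationSchemes.SliceFKN
import Literature.Combinatorics.Optimization.TracialDesignsLowDegree
import Literature.Combinatorics.Optimization.HypercubeSosUpperBounds
import HarnessLib

/-!
# The sum-of-squares degree of the knapsack quadratics `f_k(x) = (|x| − k)(|x| − k − 1)` on the cube
# (Lee–Raghavendra–Steurer 2015, Thm 1.12, after Grigoriev 2001) and on the slice `C([n],t)`

Topic `Literature/Combinatorics/Optimization`; companion of `KnapsackPseudoDensity.lean` (Grigoriev's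
knapsack pseudo-density `D_r` on `{0,1}^m`, `E_x D_r(x) P(x) = 𝒢_r(P)`) and `SosPseudoDensityDuality.lean`
(LRS §2: "`deg_sos(f) > d` iff some degree-`d` pseudo-density has `E D f < 0`").  Everything here is
PROVED; no named facts.

Lee–Raghavendra–Steurer quote Grigoriev's knapsack theorem in the CUBE-CERTIFICATE currency of their §1:

> **Theorem 1.12 ([Gri01]).** For every odd integer `m ≥ 1`, the function `f : {0,1}^m → ℝ_{≥0}`
> given by `f(x) = (m/2 − Σ_{i=1}^m x_i)² − 1/4` has `deg_sos(f) ≥ m + 1`.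

(`deg_sos(f) ≥ m + 1` = "no sum-of-squares certificate `f = Σ g_i²` on the cube with `deg g_i ≤ m/2`",
i.e. `¬ HasSosCertificate m f` in the vocabulary of `PatternMatrixPsdRank.lean`.)  The tree so far
records Grigoriev's theorem only in REFUTATION currency (`Knapsack.not_hasSOSRefutation`,
`KnapsackSosLowerBound.lean`; cf. the note in `SDPRelaxationsMaxCSP.lean`).  This file proves the
cube-certificate form, for the whole family of **knapsack quadratics**
`f_k(x) = (|x| − k)(|x| − k − 1)` of Lee–Prakash–de Wolf–Yuen (`fallingQuadratic m k`; LRS's `f` is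
`f_k` with `m = 2k + 1`), in Grigoriev's full window, by the printed mechanism: Grigoriev's functional
at the half-integer `r = k + ½` is a pseudo-density of degree `2l` on the cube whenever `2l ≤ m`,
`l ≤ k + 1`, `l + k ≤ m` (`isPseudoDensity_knapsackDensity_of_window`, Grigoriev's Lemma 1.4 in the
window `l − 1 < r < m − l + 1`), and `E_x D_r(x) f_k(x) = 𝒢_r(F_k) = (r − k)(r − k − 1) = −¼ < 0`
(`cubeExpect_knapsackDensity_mul_fallingQuadratic`, Grigoriev's Lemma 1.3), so weak duality
(`IsPseudoDensity.cubeExpect_mul_nonneg`) forbids a certificate with Gram factors of degree `≤ l`: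

* `not_hasSosCertificate_fallingQuadratic_of_window` — `2 ≤ m`, `2(d/2) ≤ m`, `d/2 ≤ k + 1`,
  `d/2 + k ≤ m` ⟹ `¬ HasSosCertificate d (fallingQuadratic m k)`;
* `not_hasSosCertificate_fallingQuadratic` — the memorable case `2k + 2 ≤ m`, `d ≤ 2k + 3`
  (Gram degree `k + 1` does not suffice; by Lee–Prakash–de Wolf–Yuen Thm 4.3 /
  `KnapsackSosUpperBound.lean` degree `k + 2` suffices on the knapsack quotient);
* `LeeRaghavendraSteurer2015_thm112` — Thm 1.12 as printed, for odd `m ≥ 3` (for `m = 1` the printed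
  `f` is identically `0` on `{0,1}` and the statement is vacuous-false; LRS use it for large `m` only),
  and `not_hasSosCertificate_knapsackGap` for the normalised `f` of LRS eq. (5.1) (`knapsackGap`).

**The slice.**  The second part transfers the bound to the Johnson slice `C([n],t)` (the home of the
`pnp-psdrank` cell's cut-indexed fields): for `A ⊆ [n]` the function
`g_{A,k}(U) = (|U ∩ A| − k)(|U ∩ A| − k − 1)` is a nonnegative function of Johnson degree `2` on
`C([n],t)`, and it is NOT a sum of squares of functions of Johnson degree `≤ l` on `C([n],t)`
(degree on the slice = `SliceFKN.HasDegreeLEOn`, Filmus's "agrees on the slice with a multilinear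
polynomial of degree `≤ l`", equivalently: lies in the span of the containment indicators `1[S ⊆ U]`,
`|S| ≤ l`) whenever `2l ≤ |A|`, `l ≤ k + 1`, `l + k ≤ |A|`, `|A| ≤ t` and `t + |A| ≤ n`
(`not_sliceSos_interFallingQuadratic_of_window`; headline `not_sliceSos_interFallingQuadratic`:
`|A| = 2k + 2 ≤ t ≤ n − 2k − 2` ⟹ Gram degree `k + 1 = |A|/2` does not suffice).  Mechanism
(folklore restriction argument, ours): the sub-cube `z ↦ U_z = a(z⁻¹(1)) ∪ b(z⁻¹(0)) ∪ C₀` of the slice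
(`a` enumerating `A`, `b` a set of `|A|` partners outside `A`, `C₀` a padding set, `|U_z| = t`,
`U_z ∩ A = a(z⁻¹(1))`) pulls a slice certificate back to a cube certificate of the same Gram degree for
`f_k` on `{0,1}^{|A|}` (`hasDegreeLE_comp_cubeToSlice`: the containment indicator `1[S ⊆ U_z]` is the
product polynomial `∏_{a_i ∈ S} z_i ∏_{b_i ∈ S} (1 − z_i)` of degree `≤ |S|`), contradicting the first part.
So on `C([n],t)` there are nonnegative functions of Johnson degree `2` all of whose Gram
factorizations have Johnson degree `> t/2 − 1` (take `|A| = t` or `t − 1` even): the scalar shadow of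
the "Gram degree `t` versus Grigoriev range `t/2`" gap discussed in the cell (MEMO-20 §2(d), LIT-36 §2).

**The cell's vocabulary (Part III, v2).**  The `pnp-psdrank` bricks index cut fields by `OddSet n` and express
'Johnson degree `≤ k`' of a Gram factor `U ↦ B_U` as `IsLowDegreeU n k B` (`TracialDesignsLowDegree.lean`: every
entry lies in the span of the containment indicators `1[A' ⊆ U]`, `|A'| ≤ k`).  `IsLowDegreeU.hasDegreeLEOn_entry`
is the bridge to Filmus's slice degree (`SliceFKN.HasDegreeLEOn` on `C([n],t)`, `t` odd, for the entry extended by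
`0` off the odd sets), and `not_isLowDegreeU_gram_interFallingQuadratic` restates the slice theorem there: no Gram
field `X_U = B_U B_Uᵀ` with `IsLowDegreeU n (k+1) B` has a diagonal entry equal to `g_{A,k}(U)` on the `t`-cuts
(`|A| = 2k + 2 ≤ t ≤ n − 2k − 2`, `t` odd).

**Upper bounds (Part IV, v3).**  On top of `HypercubeSosUpperBounds.lean` (Fawzi–Saunderson–Parrilo 2016
Thm 2 = Laurent's conjecture, and the Sakaue–Takeda–Kim–Ito 2017 bound `⌈(m+r−1)/2⌉`, proved there) the
thresholds are closed from above: `hasSosCertificate_fallingQuadratic` (`f_k` is `(⌊m/2⌋+1)`-sos on `{0,1}^m`,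
every `k`), the exact sos degrees `hasSosCertificate_fallingQuadratic_iff_even` (`m = 2k+2`: certificate of
degree `d` iff `d ≥ 2k+4`) / `_iff_odd` (`m = 2k+1 ≥ 3`: iff `d ≥ 2k+2`) and
`LeeRaghavendraSteurer2015_thm112_tight` (`deg_sos(f) = m + 1` exactly for LRS's `f`, odd `m`); on the slice
`sliceSos_interFallingQuadratic` (`g_{A,k}` IS a sum of squares of Johnson degree `⌊|A|/2⌋ + 1` on every domain,
by pulling the cube certificate back along `U ↦ z_A(U)`, `hasDegreeLEOn_comp_restrictToCoords`), the exact
threshold `sliceSos_interFallingQuadratic_iff` (`|A| = 2k+2 ≤ t ≤ n−2k−2`: Johnson degree `l` suffices iff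
`l ≥ k + 2`), and in the cell's currency `isLowDegreeU_gram_interFallingQuadratic` (a Gram factor
`B : OddSet n → ℝ^{1×J}` with `IsLowDegreeU n (|A|/2+1) B` and `(B_U B_Uᵀ)₀₀ = g_{A,k}(U)` on all odd cuts).
Still not treated: the exact cube sos degree of `f_k` for UNBALANCED `k` (`m ∉ {2k+1, 2k+2}`: the window gives
`> min(⌊m/2⌋, k+1, m−k)`, the upper bound is `⌊m/2⌋ + 1`), and Laurent's CUT-polytope statement itself
(the moment side, FSP16 Cor. 3).

## References

* [LeeRaghavendraSteurer2015] J. R. Lee, P. Raghavendra, D. Steurer, *Lower bounds on the size of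
  semidefinite programming relaxations*, STOC 2015, arXiv:1411.6317 — Thm 1.12 (p. 8), §2 (pseudo-
  densities, deg_sos), Thm 5.3 (p. 22).  Held text `paper:arxiv-1411.6317`.
* [Grigoriev2001] D. Grigoriev, *Complexity of Positivstellensatz proofs for the knapsack*, comput.
  complexity 10 (2001) 139–154 — Lemmas 1.3–1.4, Theorem (i).
* [LeePrakashDewolfYuen2016] T. Lee, A. Prakash, R. de Wolf, H. Yuen, *On the sum-of-squares degree of
  symmetric quadratic functions*, CCC 2016, arXiv:1601.02311 — §1.2 (the functions `f_k`), §4.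
* [KurpiszLeppanenMastrolilli2016] A. Kurpisz, S. Leppänen, M. Mastrolilli, *Tight sum-of-squares lower
  bounds for binary polynomial optimization problems*, ICALP 2016, arXiv:1605.03019 — p. 3 (context:
  the balanced falling factorials, Laurent's theorem).
* [FilmusIhringer2019] Y. Filmus, F. Ihringer, *Boolean constant degree functions on the slice are
  juntas*, §2 (degree on the slice) — vocabulary `SliceFKN.HasDegreeLEOn`.
* [FawziSaundersonParrilo2016] H. Fawzi, J. Saunderson, P. A. Parrilo, Math. Program. 160 (2016), Thm 2
  (Laurent's conjecture) — proved in `HypercubeSosUpperBounds.lean` (Part IV's input).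
* [SakaueEtAl2017] S. Sakaue, A. Takeda, S. Kim, N. Ito, SIAM J. Optim. 27 (2017) 565–582 — the bound
  `⌈(m+r−1)/2⌉` (as quoted in [KurpiszLeppanenMastrolilli2016] p. 3), proved in `HypercubeSosUpperBounds.lean`.
-/

noncomputable section

open Finset MvPolynomial
open Literature.Computability.Complexity.Knapsack (functional functional_one
  functional_mul_self_nonneg functional_knapsack_mul)
open Literature.Combinatorics.AssociationSchemes (JohnsonHarmonics.zeta JohnsonHarmonics.zeta_apply
  SliceFKN.HasDegreeLEOn)

namespace Literature.Combinatorics.Optimization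

variable {m : ℕ}

/-! ### Part I — the cube `{0,1}^m` -/

/-! #### Grigoriev's pseudo-density in the full window -/

/-- **The knapsack pseudo-density in Grigoriev's window.** For `2l ≤ m` and `l − 1 < r < m − l + 1`
(`l = d/2`) the function `D_r = knapsackDensity m r` is a degree-`d` pseudo-density on `{0,1}^m`:
`E D_r = 1` and `E D_r g² = 𝒢_r(P²) ≥ 0` for `deg g ≤ d/2`.  (`KnapsackPseudoDensity.lean` records the
case `r = m/2` used by LRS; the proof is the same.)
[cite: LeeRaghavendraSteurer2015, Thm 5.3 (p. 22)] [cite: Grigoriev2001, Lemma 1.4 (PDF p. 8)] -/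
theorem isPseudoDensity_knapsackDensity_of_window {d : ℕ} {r : ℝ} (hd : 2 * (d / 2) ≤ m)
    (hr₁ : ((d / 2 : ℕ) : ℝ) - 1 < r) (hr₂ : r < (m : ℝ) - (d / 2 : ℕ) + 1) :
    IsPseudoDensity d (knapsackDensity m r) := by
  refine ⟨cubeExpect_knapsackDensity _, fun g hg => ?_⟩
  obtain ⟨P, hP, hPg⟩ := hg
  have h := cubeExpect_knapsackDensity_mul_eval r (P * P)
  have heq : (fun x => knapsackDensity m r x * g x ^ 2) =
      fun x => knapsackDensity m r x * MvPolynomial.eval (cubePoint x) (P * P) := by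
    funext x; rw [map_mul, hPg x, sq]
  rw [heq, h]
  exact functional_mul_self_nonneg (l := d / 2) hd hr₁ hr₂ hP

/-! #### The knapsack quadratics `f_k` -/

/-- **The knapsack quadratic** `f_k(x) = (|x| − k)(|x| − k − 1)` on `{0,1}^m` (`|x| = Σ_i x_i`).
[cite: LeePrakashDewolfYuen2016, §1.2 ("f_k(x) = (|x| − k)(|x| − k − 1) for k = 0, 1, 2, …, n−1")] -/
def fallingQuadratic (m k : ℕ) (x : Fin m → Bool) : ℝ :=
  ((∑ i, cubePoint x i) - k) * ((∑ i, cubePoint x i) - k - 1)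

/-- `f_k` in terms of the Hamming weight. [cite: LeePrakashDewolfYuen2016, §1.2] -/
theorem fallingQuadratic_eq_card (k : ℕ) (x : Fin m → Bool) :
    fallingQuadratic m k x = (((trueSet x).card : ℝ) - k) * (((trueSet x).card : ℝ) - k - 1) := by
  rw [fallingQuadratic, sum_cubePoint_eq_card]

/-- `f_k ≥ 0` on the cube (a product of two consecutive integers).
[cite: LeePrakashDewolfYuen2016, §1.2 ("non-negative functions f_k")] -/
theorem fallingQuadratic_nonneg (k : ℕ) (x : Fin m → Bool) : 0 ≤ fallingQuadratic m k x := by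
  rw [fallingQuadratic_eq_card]
  rcases le_or_gt (trueSet x).card k with h | h
  · have h1 : ((trueSet x).card : ℝ) ≤ k := by exact_mod_cast h
    exact mul_nonneg_of_nonpos_of_nonpos (by linarith) (by linarith)
  · have h1 : (k : ℝ) + 1 ≤ (trueSet x).card := by exact_mod_cast h
    exact mul_nonneg (by linarith) (by linarith)

/-- The representing polynomial `F_k = (Σ X_i − k)(Σ X_i − k − 1)`.
[cite: LeePrakashDewolfYuen2016, §4 (knapsack)] -/
def fallingPoly (m k : ℕ) : MvPolynomial (Fin m) ℝ :=
  ((∑ i, X i) - C (k : ℝ)) * ((∑ i, X i) - C ((k : ℝ) + 1))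

/-- `F_k` represents `f_k` on the cube. [cite: LeePrakashDewolfYuen2016, §1.2] -/
theorem eval_fallingPoly (k : ℕ) (x : Fin m → Bool) :
    MvPolynomial.eval (cubePoint x) (fallingPoly m k) = fallingQuadratic m k x := by
  simp only [fallingPoly, fallingQuadratic, map_mul, map_sub, map_sum, eval_X, eval_C]
  ring

/-- **Grigoriev's functional on `F_k`:** `𝒢_r(F_k) = (r − k)(r − k − 1)` (`m ≥ 2`), since
`F_k = (Σ X_i − r)(Σ X_i + r − 2k − 1) + (r − k)(r − k − 1)` and `𝒢_r((Σ X_i − r)·g) = 0` for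
`deg g < m` (Lemma 1.3). [cite: Grigoriev2001, Lemma 1.3 (PDF p. 8)] -/
theorem functional_fallingPoly (hm : 2 ≤ m) (k : ℕ) (r : ℝ) :
    functional m r (fallingPoly m k) = (r - k) * (r - k - 1) := by
  have hF : fallingPoly m k = ((∑ j : Fin m, X j) - C r) * ((∑ j : Fin m, X j) + C (r - k - k - 1)) +
      C ((r - k) * (r - k - 1)) := by
    simp only [fallingPoly, map_sub, map_mul, map_add, map_one]
    ring
  have hdeg : ((∑ j : Fin m, X j) + C (r - k - k - 1) : MvPolynomial (Fin m) ℝ).totalDegree < m := by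
    refine lt_of_le_of_lt ((totalDegree_add _ _).trans (max_le ?_ ?_)) (by omega : 1 < m)
    · exact (totalDegree_finsetSum _ _).trans (Finset.sup_le fun j _ => (totalDegree_X j).le)
    · rw [totalDegree_C]; exact zero_le_one
  rw [hF, map_add, functional_knapsack_mul r hdeg, zero_add, MvPolynomial.C_eq_smul_one, map_smul,
    functional_one, smul_eq_mul, mul_one]

/-- **`E_x D_r(x) f_k(x) = (r − k)(r − k − 1)`** (`m ≥ 2`): the pseudo-density prices `f_k` by
Grigoriev's functional. [cite: LeeRaghavendraSteurer2015, Thm 5.3 proof (p. 22: "E_x D(x) p(x) = 𝒢(p)")]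
[cite: Grigoriev2001, Lemma 1.3 (PDF p. 8)] -/
theorem cubeExpect_knapsackDensity_mul_fallingQuadratic (hm : 2 ≤ m) (k : ℕ) (r : ℝ) :
    cubeExpect (fun x => knapsackDensity m r x * fallingQuadratic m k x) = (r - k) * (r - k - 1) := by
  have h := cubeExpect_knapsackDensity_mul_eval r (fallingPoly m k)
  simp_rw [eval_fallingPoly] at h
  rw [h, functional_fallingPoly hm]

/-! #### No low-degree cube certificate -/

/-- **No sum-of-squares certificate for `f_k` in Grigoriev's window.** If `2 ≤ m`, `2(d/2) ≤ m`,
`d/2 ≤ k + 1` and `d/2 + k ≤ m`, then `f_k` is not `Σ g_i²` on `{0,1}^m` with `deg g_i ≤ d/2`: the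
pseudo-density `D_{k+½}` has `E D f_k = −¼ < 0`.
[cite: LeeRaghavendraSteurer2015, Thm 1.12 (p. 8) and §2 (weak duality)]
[cite: Grigoriev2001, Theorem (i) (PDF p. 6), Lemmas 1.3–1.4 (PDF p. 8)] -/
theorem not_hasSosCertificate_fallingQuadratic_of_window {k d : ℕ} (hm : 2 ≤ m)
    (hd : 2 * (d / 2) ≤ m) (h₁ : d / 2 ≤ k + 1) (h₂ : d / 2 + k ≤ m) :
    ¬ HasSosCertificate d (fallingQuadratic m k) := by
  intro hsos
  have h₁' : ((d / 2 : ℕ) : ℝ) ≤ k + 1 := by exact_mod_cast h₁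
  have h₂' : ((d / 2 : ℕ) : ℝ) + k ≤ m := by exact_mod_cast h₂
  have hD : IsPseudoDensity d (knapsackDensity m ((k : ℝ) + 1 / 2)) :=
    isPseudoDensity_knapsackDensity_of_window hd (by linarith) (by linarith)
  have h0 := hD.cubeExpect_mul_nonneg hsos
  rw [cubeExpect_knapsackDensity_mul_fallingQuadratic hm k] at h0
  have : ((k : ℝ) + 1 / 2 - k) * ((k : ℝ) + 1 / 2 - k - 1) = -(1 / 4) := by ring
  linarith

/-- **The knapsack quadratic `f_k` has sos degree `> k + 1` on `{0,1}^m` for `m ≥ 2k + 2`:** no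
certificate `f_k = Σ g_i²` with `deg g_i ≤ k + 1` (`d ≤ 2k + 3`).  (On the knapsack quotient the
threshold is exactly `k + 2`: `KnapsackSosUpperBound.lean`.)
[cite: Grigoriev2001, Theorem (i) (PDF p. 6)] [cite: LeePrakashDewolfYuen2016, §1.2, §4 (Thms 4.2–4.3)] -/
theorem not_hasSosCertificate_fallingQuadratic {k d : ℕ} (hm : 2 * k + 2 ≤ m) (hd : d ≤ 2 * k + 3) :
    ¬ HasSosCertificate d (fallingQuadratic m k) :=
  not_hasSosCertificate_fallingQuadratic_of_window (by omega) (by omega) (by omega) (by omega)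

/-- **Lee–Raghavendra–Steurer 2015, Theorem 1.12 (after Grigoriev 2001)**, as printed: for odd
`m ≥ 3` the function `f(x) = (m/2 − Σ_i x_i)² − 1/4` on `{0,1}^m` has `deg_sos(f) ≥ m + 1`, i.e. no
sum-of-squares certificate with Gram factors of degree `≤ m/2 = (m−1)/2`.  (`f = f_k` with
`m = 2k + 1`; `m = 1` is excluded: there `f ≡ 0` on `{0,1}`.)
[cite: LeeRaghavendraSteurer2015, Thm 1.12 (p. 8)] [cite: Grigoriev2001, Theorem (i) (PDF p. 6)] -/
theorem LeeRaghavendraSteurer2015_thm112 (hodd : Odd m) (hm : 3 ≤ m) :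
    ¬ HasSosCertificate m
      (fun x : Fin m → Bool => ((m : ℝ) / 2 - ∑ i, cubePoint x i) ^ 2 - 1 / 4) := by
  obtain ⟨k, rfl⟩ := hodd
  have hf : (fun x : Fin (2 * k + 1) → Bool =>
      (((2 * k + 1 : ℕ) : ℝ) / 2 - ∑ i, cubePoint x i) ^ 2 - 1 / 4) = fallingQuadratic (2 * k + 1) k := by
    funext x
    simp only [fallingQuadratic]
    push_cast
    ring
  rw [hf]
  exact not_hasSosCertificate_fallingQuadratic_of_window (by omega) (by omega) (by omega) (by omega)

/-- **Theorem 1.12 for the normalised `f` of eq. (5.1)** (`knapsackGap m x = m⁻²((Σ x_i − m/2)² − ¼)`):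
for odd `m ≥ 3`, `¬ HasSosCertificate m (knapsackGap m)`.
[cite: LeeRaghavendraSteurer2015, Thm 1.12 (p. 8), eq. (5.1) (p. 23)] -/
theorem not_hasSosCertificate_knapsackGap (hodd : Odd m) (hm : 3 ≤ m) :
    ¬ HasSosCertificate m (knapsackGap m) := by
  intro h
  have hm0 : (0 : ℝ) ≤ (m : ℝ) ^ 2 := by positivity
  have h' := h.const_mul hm0
  refine LeeRaghavendraSteurer2015_thm112 hodd hm ?_
  have heq : (fun x : Fin m → Bool => ((m : ℝ) / 2 - ∑ i, cubePoint x i) ^ 2 - 1 / 4) =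
      fun x => (m : ℝ) ^ 2 * knapsackGap m x := by
    funext x
    have hm' : (m : ℝ) ≠ 0 := by exact_mod_cast (by omega : m ≠ 0)
    unfold knapsackGap
    field_simp
    ring
  rw [heq]
  exact h'

/-! ### Part II — the slice `C([n],t)` -/

section Slice

variable {n μ : ℕ}

/-- Coordinates of a cube point. [cite: LeeRaghavendraSteurer2015, §2 (functions on the discrete cube)] -/
theorem cubePoint_of_eq_true {z : Fin μ → Bool} {i : Fin μ} (h : z i = true) : cubePoint z i = 1 := by
  simp [cubePoint, h]

/-- Coordinates of a cube point. [cite: LeeRaghavendraSteurer2015, §2 (functions on the discrete cube)] -/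
theorem cubePoint_of_eq_false {z : Fin μ → Bool} {i : Fin μ} (h : z i = false) : cubePoint z i = 0 := by
  simp [cubePoint, h]

/-- The sub-cube of the slice used for the restriction: `U_z = a(z⁻¹(1)) ∪ b(z⁻¹(0)) ∪ C₀`.
[folklore] -/
def cubeToSlice (a b : Fin μ → Fin n) (C₀ : Finset (Fin n)) (z : Fin μ → Bool) : Finset (Fin n) :=
  (univ.filter fun i => z i = true).image a ∪ (univ.filter fun i => z i = false).image b ∪ C₀

/-- Membership in `U_z`. [folklore] -/
private theorem mem_cubeToSlice (a b : Fin μ → Fin n) (C₀ : Finset (Fin n)) (z : Fin μ → Bool) (s : Fin n) :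
    s ∈ cubeToSlice a b C₀ z ↔
      (∃ i, z i = true ∧ a i = s) ∨ (∃ i, z i = false ∧ b i = s) ∨ s ∈ C₀ := by
  simp only [cubeToSlice, mem_union, mem_image, mem_filter, mem_univ, true_and, or_assoc]

/-- The product polynomial `∏_{i : a_i ∈ S} z_i · ∏_{i : b_i ∈ S} (1 − z_i)` reading the containment
`S ⊆ U_z` on the sub-cube. [folklore] -/
def containPoly (a b : Fin μ → Fin n) (S : Finset (Fin n)) : MvPolynomial (Fin μ) ℝ :=
  ∏ i, ((if a i ∈ S then X i else 1) * (if b i ∈ S then 1 - X i else 1))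

/-- Evaluation of the product polynomial at a cube point: the indicator of
"`a_i ∈ S → z_i = 1` and `b_i ∈ S → z_i = 0` for all `i`". [folklore] -/
private theorem eval_containPoly (a b : Fin μ → Fin n) (S : Finset (Fin n)) (z : Fin μ → Bool) :
    MvPolynomial.eval (cubePoint z) (containPoly a b S) =
      if (∀ i, (a i ∈ S → z i = true) ∧ (b i ∈ S → z i = false)) then 1 else 0 := by
  classical
  unfold containPoly
  rw [map_prod]
  split_ifs with H
  · refine prod_eq_one fun i _ => ?_
    rw [map_mul]
    have h1 : MvPolynomial.eval (cubePoint z)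
        (if a i ∈ S then X i else 1 : MvPolynomial (Fin μ) ℝ) = 1 := by
      by_cases ha : a i ∈ S
      · rw [if_pos ha, eval_X, cubePoint_of_eq_true ((H i).1 ha)]
      · rw [if_neg ha, map_one]
    have h2 : MvPolynomial.eval (cubePoint z)
        (if b i ∈ S then 1 - X i else 1 : MvPolynomial (Fin μ) ℝ) = 1 := by
      by_cases hb : b i ∈ S
      · rw [if_pos hb, map_sub, map_one, eval_X, cubePoint_of_eq_false ((H i).2 hb), sub_zero]
      · rw [if_neg hb, map_one]
    rw [h1, h2, mul_one]
  · obtain ⟨i, hi⟩ := not_forall.1 H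
    refine prod_eq_zero (mem_univ i) ?_
    rw [map_mul]
    by_cases ha : a i ∈ S ∧ z i = false
    · have : MvPolynomial.eval (cubePoint z)
          (if a i ∈ S then X i else 1 : MvPolynomial (Fin μ) ℝ) = 0 := by
        rw [if_pos ha.1, eval_X, cubePoint_of_eq_false ha.2]
      rw [this, zero_mul]
    · have ha' : a i ∈ S → z i = true := fun h => by
        cases hz : z i
        · exact absurd ⟨h, hz⟩ ha
        · rfl
      have hQ : ¬ (b i ∈ S → z i = false) := fun hq => hi ⟨ha', hq⟩
      obtain ⟨hbS, hz⟩ := Classical.not_imp.1 hQ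
      have hz' : z i = true := by simpa using hz
      have : MvPolynomial.eval (cubePoint z)
          (if b i ∈ S then 1 - X i else 1 : MvPolynomial (Fin μ) ℝ) = 0 := by
        rw [if_pos hbS, map_sub, map_one, eval_X, cubePoint_of_eq_true hz', sub_self]
      rw [this, mul_zero]

/-- Degree of the product polynomial: at most `|S|` when `a`, `b` are injective with disjoint ranges.
[folklore] -/
private theorem totalDegree_containPoly_le {a b : Fin μ → Fin n} (ha : Function.Injective a)
    (hb : Function.Injective b) (hab : ∀ i j, a i ≠ b j) (S : Finset (Fin n)) :
    (containPoly a b S).totalDegree ≤ S.card := by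
  classical
  unfold containPoly
  refine (totalDegree_finsetProd _ _).trans ?_
  have hterm : ∀ i, ((if a i ∈ S then X i else 1 : MvPolynomial (Fin μ) ℝ) *
      (if b i ∈ S then 1 - X i else 1)).totalDegree ≤
        (if a i ∈ S then 1 else 0) + (if b i ∈ S then 1 else 0) := by
    intro i
    refine (totalDegree_mul _ _).trans (add_le_add ?_ ?_)
    · split_ifs with h
      · exact (totalDegree_X _).le
      · simp
    · split_ifs with h
      · refine (totalDegree_sub _ _).trans (max_le (by simp) (totalDegree_X _).le)
      · simp
  refine (sum_le_sum fun i _ => hterm i).trans ?_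
  rw [sum_add_distrib, ← card_filter, ← card_filter]
  rw [← card_image_of_injective (univ.filter fun i => a i ∈ S) ha,
    ← card_image_of_injective (univ.filter fun i => b i ∈ S) hb, ← card_union_of_disjoint]
  · refine card_le_card fun s hs => ?_
    rw [mem_union] at hs
    rcases hs with hs | hs
    · obtain ⟨i, hi, rfl⟩ := mem_image.1 hs
      exact (mem_filter.1 hi).2
    · obtain ⟨i, hi, rfl⟩ := mem_image.1 hs
      exact (mem_filter.1 hi).2
  · rw [disjoint_left]
    intro s hs hs'
    obtain ⟨i, -, rfl⟩ := mem_image.1 hs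
    obtain ⟨j, -, hj⟩ := mem_image.1 hs'
    exact hab i j hj.symm

/-- **Containment read on the sub-cube.** If `a`, `b` are injective, `a_i ≠ b_j`, and `C₀` avoids both
ranges, then `S ⊆ U_z` iff `S ⊆ a(univ) ∪ b(univ) ∪ C₀` and, for all `i`, `a_i ∈ S → z_i = 1` and
`b_i ∈ S → z_i = 0`. [folklore] -/
private theorem subset_cubeToSlice_iff {a b : Fin μ → Fin n} {C₀ : Finset (Fin n)} (ha : Function.Injective a)
    (hb : Function.Injective b) (hab : ∀ i j, a i ≠ b j) (haC : ∀ i, a i ∉ C₀) (hbC : ∀ i, b i ∉ C₀)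
    (S : Finset (Fin n)) (z : Fin μ → Bool) :
    S ⊆ cubeToSlice a b C₀ z ↔
      S ⊆ univ.image a ∪ univ.image b ∪ C₀ ∧
        ∀ i, (a i ∈ S → z i = true) ∧ (b i ∈ S → z i = false) := by
  constructor
  · intro hS
    refine ⟨fun s hs => ?_, fun i => ⟨fun hi => ?_, fun hi => ?_⟩⟩
    · have := (mem_cubeToSlice a b C₀ z s).1 (hS hs)
      simp only [mem_union, mem_image, mem_univ, true_and]
      rcases this with ⟨i, -, rfl⟩ | ⟨i, -, rfl⟩ | h
      · exact Or.inl (Or.inl ⟨i, rfl⟩)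
      · exact Or.inl (Or.inr ⟨i, rfl⟩)
      · exact Or.inr h
    · rcases (mem_cubeToSlice a b C₀ z _).1 (hS hi) with ⟨j, hj, hji⟩ | ⟨j, -, hji⟩ | h
      · rwa [← ha hji]
      · exact absurd hji.symm (hab i j)
      · exact absurd h (haC i)
    · rcases (mem_cubeToSlice a b C₀ z _).1 (hS hi) with ⟨j, -, hji⟩ | ⟨j, hj, hji⟩ | h
      · exact absurd hji (hab j i)
      · rwa [← hb hji]
      · exact absurd h (hbC i)
  · rintro ⟨hS, hz⟩ s hs
    rw [mem_cubeToSlice]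
    have := hS hs
    simp only [mem_union, mem_image, mem_univ, true_and] at this
    rcases this with (⟨i, rfl⟩ | ⟨i, rfl⟩) | h
    · exact Or.inl ⟨i, (hz i).1 hs, rfl⟩
    · exact Or.inr (Or.inl ⟨i, (hz i).2 hs, rfl⟩)
    · exact Or.inr (Or.inr h)

/-- **Restriction of slice-degree to the sub-cube.** If `h` has Johnson degree `≤ l` on `C([n],t)`
(`SliceFKN.HasDegreeLEOn`) and every `U_z` is a `t`-set, then `z ↦ h(U_z)` has degree `≤ l` on the cube
`{0,1}^μ`: `h(U_z) = Σ_{|S| ≤ l} v_S 1[S ⊆ U_z]` and each containment indicator is a product polynomial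
of degree `≤ |S|`. [folklore] [cite: FilmusIhringer2019, §2 (p. 4: degree on the slice)] -/
theorem hasDegreeLE_comp_cubeToSlice {a b : Fin μ → Fin n} {C₀ : Finset (Fin n)} {t l : ℕ}
    (ha : Function.Injective a) (hb : Function.Injective b) (hab : ∀ i j, a i ≠ b j)
    (haC : ∀ i, a i ∉ C₀) (hbC : ∀ i, b i ∉ C₀) (hcard : ∀ z, (cubeToSlice a b C₀ z).card = t)
    {h : Finset (Fin n) → ℝ} (hh : SliceFKN.HasDegreeLEOn (univ.powersetCard t) l h) :
    HasDegreeLE l (fun z => h (cubeToSlice a b C₀ z)) := by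
  classical
  obtain ⟨v, hv, hhv⟩ := hh
  -- the full containment indicator polynomial of `S`
  let Q : Finset (Fin n) → MvPolynomial (Fin μ) ℝ := fun S =>
    if S ⊆ univ.image a ∪ univ.image b ∪ C₀ then containPoly a b S else 0
  have hQeval : ∀ S z, MvPolynomial.eval (cubePoint z) (Q S) =
      if S ⊆ cubeToSlice a b C₀ z then 1 else 0 := by
    intro S z
    simp only [Q]
    by_cases hS : S ⊆ univ.image a ∪ univ.image b ∪ C₀
    · rw [if_pos hS, eval_containPoly]
      by_cases hz : ∀ i, (a i ∈ S → z i = true) ∧ (b i ∈ S → z i = false)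
      · rw [if_pos hz, if_pos ((subset_cubeToSlice_iff ha hb hab haC hbC S z).2 ⟨hS, hz⟩)]
      · rw [if_neg hz, if_neg fun h => hz ((subset_cubeToSlice_iff ha hb hab haC hbC S z).1 h).2]
    · rw [if_neg hS, map_zero,
        if_neg fun h => hS ((subset_cubeToSlice_iff ha hb hab haC hbC S z).1 h).1]
  have hQdeg : ∀ S, (Q S).totalDegree ≤ S.card := by
    intro S
    simp only [Q]
    split_ifs
    · exact totalDegree_containPoly_le ha hb hab S
    · simp
  refine ⟨∑ S ∈ univ.filter (fun S : Finset (Fin n) => S.card ≤ l), C (v S) * Q S, ?_, fun z => ?_⟩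
  · refine (totalDegree_finsetSum _ _).trans (Finset.sup_le fun S hS => ?_)
    refine (totalDegree_mul _ _).trans ?_
    rw [totalDegree_C, zero_add]
    exact (hQdeg S).trans (mem_filter.1 hS).2
  · have hU : cubeToSlice a b C₀ z ∈ univ.powersetCard t := mem_powersetCard_univ.2 (hcard z)
    show _ = h (cubeToSlice a b C₀ z)
    set U := cubeToSlice a b C₀ z with hUdef
    rw [hhv _ hU, JohnsonHarmonics.zeta_apply, map_sum]
    simp_rw [map_mul, eval_C, hQeval]
    have hL : ∑ S ∈ univ.filter (fun S : Finset (Fin n) => S.card ≤ l),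
        v S * (if S ⊆ U then (1 : ℝ) else 0) = ∑ S ∈ (U.powerset).filter (fun S => S.card ≤ l), v S :=
      calc ∑ S ∈ univ.filter (fun S : Finset (Fin n) => S.card ≤ l), v S * (if S ⊆ U then (1 : ℝ) else 0)
          = ∑ S ∈ univ.filter (fun S : Finset (Fin n) => S.card ≤ l), (if S ⊆ U then v S else 0) :=
            sum_congr rfl fun S _ => by split_ifs <;> simp
        _ = ∑ S ∈ (univ.filter (fun S : Finset (Fin n) => S.card ≤ l)).filter (fun S => S ⊆ U), v S :=
            (sum_filter _ _).symm
        _ = ∑ S ∈ (U.powerset).filter (fun S => S.card ≤ l), v S := by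
            congr 1
            ext S
            simp [mem_powerset, and_comm]
    have hR : ∑ T ∈ U.powerset, v T = ∑ S ∈ (U.powerset).filter (fun S => S.card ≤ l), v S := by
      rw [← sum_filter_add_sum_filter_not U.powerset (fun S => S.card ≤ l), add_eq_left]
      exact sum_eq_zero fun T hT => hv T (not_le.1 (mem_filter.1 hT).2)
    rw [hL, hR]

/-- **No low-degree sum-of-squares representation on the slice, Grigoriev's window.**  Let
`A ⊆ [n]` with `2 ≤ |A| ≤ t` and `t + |A| ≤ n`, and let `l`, `k` satisfy `2l ≤ |A|`, `l ≤ k + 1`,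
`l + k ≤ |A|`.  Then the nonnegative Johnson-degree-`2` function
`g_{A,k}(U) = (|U ∩ A| − k)(|U ∩ A| − k − 1)` on `C([n],t)` is NOT of the form `Σ_j h_j(U)²` on
`C([n],t)` with all `h_j` of Johnson degree `≤ l` on `C([n],t)`.  Proof: restriction to the sub-cube
`U_z` (on which `|U_z ∩ A| = |z|`) would give a cube certificate of `f_k` on `{0,1}^{|A|}` with Gram
degree `l`, excluded by `not_hasSosCertificate_fallingQuadratic_of_window`.
[cite: Grigoriev2001, Theorem (i) (PDF p. 6)] [cite: LeeRaghavendraSteurer2015, Thm 1.12 (p. 8)] -/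
theorem not_sliceSos_interFallingQuadratic_of_window {n t k l : ℕ} (A : Finset (Fin n))
    (h2 : 2 ≤ A.card) (hl : 2 * l ≤ A.card) (hlk : l ≤ k + 1) (hkl : l + k ≤ A.card)
    (hAt : A.card ≤ t) (hn : t + A.card ≤ n) :
    ¬ ∃ (J : ℕ) (h : Fin J → Finset (Fin n) → ℝ),
        (∀ j, SliceFKN.HasDegreeLEOn (univ.powersetCard t) l (h j)) ∧
        ∀ U ∈ univ.powersetCard t,
          (((U ∩ A).card : ℝ) - k) * (((U ∩ A).card : ℝ) - k - 1) = ∑ j, h j U ^ 2 := by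
  classical
  rintro ⟨J, h, hdeg, hsq⟩
  set μ := A.card with hμ
  -- enumerate `A` and its complement
  let a : Fin μ ↪o Fin n := A.orderEmbOfFin hμ.symm
  have hc : Aᶜ.card = n - μ := by rw [card_compl, Fintype.card_fin]
  let e : Fin (n - μ) ↪o Fin n := Aᶜ.orderEmbOfFin hc
  let b : Fin μ → Fin n := fun i => e ⟨i, by omega⟩
  let c : Fin (t - μ) → Fin n := fun j => e ⟨μ + j, by omega⟩
  let C₀ : Finset (Fin n) := univ.image c
  have ha_mem : ∀ i, a i ∈ A := fun i => A.orderEmbOfFin_mem hμ.symm i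
  have he_mem : ∀ j, e j ∉ A := fun j => mem_compl.1 (Aᶜ.orderEmbOfFin_mem hc j)
  have ha : Function.Injective a := a.injective
  have hb : Function.Injective b := by
    intro i j hij
    have := e.injective hij
    exact Fin.ext (by simpa using congrArg Fin.val this)
  have hcinj : Function.Injective c := by
    intro i j hij
    have := e.injective hij
    exact Fin.ext (by simpa using congrArg Fin.val this)
  have hab : ∀ i j, a i ≠ b j := fun i j hij => he_mem _ (hij ▸ ha_mem i)
  have hbc : ∀ i j, b i ≠ c j := by
    intro i j hij
    have := congrArg Fin.val (e.injective hij)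
    simp only at this
    omega
  have haC : ∀ i, a i ∉ C₀ := by
    intro i hi
    obtain ⟨j, -, hj⟩ := mem_image.1 hi
    exact he_mem _ (hj ▸ ha_mem i)
  have hbC : ∀ i, b i ∉ C₀ := by
    intro i hi
    obtain ⟨j, -, hj⟩ := mem_image.1 hi
    exact hbc i j hj.symm
  have hC₀A : ∀ s ∈ C₀, s ∉ A := by
    intro s hs
    obtain ⟨j, -, rfl⟩ := mem_image.1 hs
    exact he_mem _
  -- `U_z ∩ A = a(z⁻¹(1))` and `|U_z| = t`
  have hinter : ∀ z, cubeToSlice a b C₀ z ∩ A = (univ.filter fun i => z i = true).image a := by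
    intro z
    ext s
    rw [mem_inter, mem_cubeToSlice]
    constructor
    · rintro ⟨h1 | h2 | h3, hsA⟩
      · obtain ⟨i, hi, rfl⟩ := h1
        exact mem_image.2 ⟨i, mem_filter.2 ⟨mem_univ _, hi⟩, rfl⟩
      · obtain ⟨i, -, rfl⟩ := h2
        exact absurd hsA (he_mem _)
      · exact absurd hsA (hC₀A s h3)
    · intro hs
      obtain ⟨i, hi, rfl⟩ := mem_image.1 hs
      exact ⟨Or.inl ⟨i, (mem_filter.1 hi).2, rfl⟩, ha_mem i⟩
  have hcardInter : ∀ z, (cubeToSlice a b C₀ z ∩ A).card = (trueSet z).card := by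
    intro z
    rw [hinter, card_image_of_injective _ ha]
    rfl
  have hcard : ∀ z, (cubeToSlice a b C₀ z).card = t := by
    intro z
    have hd1 : Disjoint ((univ.filter fun i => z i = true).image a)
        ((univ.filter fun i => z i = false).image b) := by
      rw [disjoint_left]
      intro s hs hs'
      obtain ⟨i, -, rfl⟩ := mem_image.1 hs
      obtain ⟨j, -, hj⟩ := mem_image.1 hs'
      exact hab i j hj.symm
    have hd2 : Disjoint ((univ.filter fun i => z i = true).image a ∪
        (univ.filter fun i => z i = false).image b) C₀ := by
      rw [disjoint_left]
      intro s hs hs'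
      rcases mem_union.1 hs with hs | hs
      · obtain ⟨i, -, rfl⟩ := mem_image.1 hs
        exact haC i hs'
      · obtain ⟨i, -, rfl⟩ := mem_image.1 hs
        exact hbC i hs'
    rw [cubeToSlice, card_union_of_disjoint hd2, card_union_of_disjoint hd1,
      card_image_of_injective _ ha, card_image_of_injective _ hb, card_image_of_injective _ hcinj,
      card_univ, Fintype.card_fin]
    have hsplit := Finset.card_filter_add_card_filter_not (s := (univ : Finset (Fin μ)))
      (fun i => z i = true)
    have hneg : (univ.filter fun i => ¬ z i = true) = univ.filter fun i => z i = false := by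
      ext i; simp
    rw [hneg, card_univ, Fintype.card_fin] at hsplit
    omega
  -- the pulled-back cube certificate
  have hcert : HasSosCertificate (2 * l) (fallingQuadratic μ k) := by
    refine ⟨J, fun j z => h j (cubeToSlice a b C₀ z), fun j => ?_, fun z => ?_⟩
    · rw [Nat.mul_div_cancel_left l two_pos]
      exact hasDegreeLE_comp_cubeToSlice ha hb hab haC hbC hcard (hdeg j)
    · have hU : cubeToSlice a b C₀ z ∈ univ.powersetCard t := mem_powersetCard_univ.2 (hcard z)
      have := hsq _ hU
      rw [hcardInter z] at this
      rw [fallingQuadratic_eq_card]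
      exact this
  exact not_hasSosCertificate_fallingQuadratic_of_window (d := 2 * l) h2 (by omega) (by omega)
    (by omega) hcert

/-- **Headline (even `|A|`).**  For `|A| = 2k + 2 ≤ t ≤ n − 2k − 2`, the nonnegative Johnson-degree-`2`
function `g_{A,k}(U) = (|U ∩ A| − k)(|U ∩ A| − k − 1)` on `C([n],t)` is not a sum of squares of
functions of Johnson degree `≤ k + 1 = |A|/2` on `C([n],t)`.
[cite: Grigoriev2001, Theorem (i) (PDF p. 6)] [cite: LeeRaghavendraSteurer2015, Thm 1.12 (p. 8)] -/
theorem not_sliceSos_interFallingQuadratic {n t k : ℕ} (A : Finset (Fin n)) (hA : A.card = 2 * k + 2)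
    (hAt : 2 * k + 2 ≤ t) (hn : t + (2 * k + 2) ≤ n) :
    ¬ ∃ (J : ℕ) (h : Fin J → Finset (Fin n) → ℝ),
        (∀ j, SliceFKN.HasDegreeLEOn (univ.powersetCard t) (k + 1) (h j)) ∧
        ∀ U ∈ univ.powersetCard t,
          (((U ∩ A).card : ℝ) - k) * (((U ∩ A).card : ℝ) - k - 1) = ∑ j, h j U ^ 2 :=
  not_sliceSos_interFallingQuadratic_of_window A (by omega) (by omega) le_rfl (by omega) (by omega)
    (by omega)

/-- **Headline (odd `|A|`, LRS's normalisation).**  For `|A| = 2k + 1`, `3 ≤ |A| ≤ t ≤ n − |A|`, the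
function `g_{A,k}` on `C([n],t)` is not a sum of squares of functions of Johnson degree `≤ k = (|A|−1)/2`.
[cite: LeeRaghavendraSteurer2015, Thm 1.12 (p. 8)] [cite: Grigoriev2001, Theorem (i) (PDF p. 6)] -/
theorem not_sliceSos_interFallingQuadratic_odd {n t k : ℕ} (A : Finset (Fin n)) (hk : 1 ≤ k)
    (hA : A.card = 2 * k + 1) (hAt : 2 * k + 1 ≤ t) (hn : t + (2 * k + 1) ≤ n) :
    ¬ ∃ (J : ℕ) (h : Fin J → Finset (Fin n) → ℝ),
        (∀ j, SliceFKN.HasDegreeLEOn (univ.powersetCard t) k (h j)) ∧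
        ∀ U ∈ univ.powersetCard t,
          (((U ∩ A).card : ℝ) - k) * (((U ∩ A).card : ℝ) - k - 1) = ∑ j, h j U ^ 2 :=
  not_sliceSos_interFallingQuadratic_of_window A (by omega) (by omega) (by omega) (by omega) (by omega)
    (by omega)

end Slice

/-! ### Part III — the cell's vocabulary: `IsLowDegreeU` Gram factors on the odd cuts -/

section CellVocabulary

open Matrix
open Literature.Barriers.PneNP (OddSet)

/-- **Bridge `IsLowDegreeU` → slice degree.**  If every entry of `U ↦ B_U` lies in the span of the
containment indicators `1[A' ⊆ U]`, `|A'| ≤ k` (`IsLowDegreeU n k B`), then for odd `t` the entry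
`U ↦ (B_U)_{ij}` (extended by `0` to non-odd sets) has Johnson degree `≤ k` on `C([n],t)` in Filmus's sense
(`SliceFKN.HasDegreeLEOn`): its coefficient vector is the spanning combination, supported on `|S| ≤ k`.
[cite: LeeRaghavendraSteurer2015, §5 (matrix-valued low-degree functions)] [cite: FilmusIhringer2019, §2 (p. 4: degree on the slice)] -/
theorem IsLowDegreeU.hasDegreeLEOn_entry {n k r m : ℕ} {B : OddSet n → Matrix (Fin r) (Fin m) ℝ}
    (hB : IsLowDegreeU n k B) (i : Fin r) (j : Fin m) {t : ℕ} (ht : Odd t) :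
    SliceFKN.HasDegreeLEOn (univ.powersetCard t) k
      (fun U : Finset (Fin n) => if hU : Odd U.card then B ⟨U, hU⟩ i j else 0) := by
  classical
  obtain ⟨c, hc⟩ := (Submodule.mem_span_range_iff_exists_fun ℝ).1 (hB i j)
  let v : Finset (Fin n) → ℝ := fun S => if hS : S.card ≤ k then c ⟨S, hS⟩ else 0
  refine ⟨v, fun S hS => dif_neg (not_le.2 hS), fun U hU => ?_⟩
  have hUt : U.card = t := mem_powersetCard_univ.1 hU
  have hUodd : Odd U.card := hUt ▸ ht
  show (if hU : Odd U.card then B ⟨U, hU⟩ i j else 0) = _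
  rw [dif_pos hUodd]
  have h1 : B ⟨U, hUodd⟩ i j =
      ∑ A' : {A' : Finset (Fin n) // A'.card ≤ k}, c A' * (if A'.1 ⊆ U then (1 : ℝ) else 0) := by
    have := congrFun hc ⟨U, hUodd⟩
    rw [Finset.sum_apply] at this
    rw [← this]
    exact sum_congr rfl fun A' _ => by rw [Pi.smul_apply, smul_eq_mul]
  have hL : ∑ A' : {A' : Finset (Fin n) // A'.card ≤ k}, c A' * (if A'.1 ⊆ U then (1 : ℝ) else 0) =
      ∑ S ∈ univ.filter (fun S : Finset (Fin n) => S.card ≤ k), v S * (if S ⊆ U then (1 : ℝ) else 0) := by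
    rw [Finset.sum_subtype (univ.filter (fun S : Finset (Fin n) => S.card ≤ k)) (p := fun S => S.card ≤ k)
      (fun S => by simp) (fun S => v S * (if S ⊆ U then (1 : ℝ) else 0))]
    refine Fintype.sum_congr _ _ fun A' => ?_
    simp only [v, dif_pos A'.2]
  have hR : ∑ T ∈ U.powerset, v T =
      ∑ S ∈ univ.filter (fun S : Finset (Fin n) => S.card ≤ k), v S * (if S ⊆ U then (1 : ℝ) else 0) := by
    calc ∑ T ∈ U.powerset, v T = ∑ T ∈ (U.powerset).filter (fun S => S.card ≤ k), v T := by
            rw [← sum_filter_add_sum_filter_not U.powerset (fun S => S.card ≤ k), add_eq_left]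
            exact sum_eq_zero fun T hT => dif_neg (mem_filter.1 hT).2
      _ = ∑ S ∈ (univ.filter (fun S : Finset (Fin n) => S.card ≤ k)).filter (fun S => S ⊆ U), v S := by
            congr 1
            ext S
            simp [mem_powerset, and_comm]
      _ = ∑ S ∈ univ.filter (fun S : Finset (Fin n) => S.card ≤ k), (if S ⊆ U then v S else 0) :=
            sum_filter _ _
      _ = _ := sum_congr rfl fun S _ => by split_ifs <;> simp
  rw [h1, JohnsonHarmonics.zeta_apply, hL, hR]

/-- **The slice theorem in the cell's currency.**  For odd `t`, `A ⊆ [n]` with `|A| = 2k + 2 ≤ t` and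
`t + 2k + 2 ≤ n`, and any family of Gram factors `B_U` (`U` an odd cut) of Johnson degree `≤ k + 1` in the
sense `IsLowDegreeU n (k+1) B`: no diagonal entry of the Gram field `X_U = B_U B_Uᵀ` equals
`g_{A,k}(U) = (|U ∩ A| − k)(|U ∩ A| − k − 1)` on all `t`-cuts.  (So the nonnegative Johnson-degree-`2` scalar
field `g_{A,k}(U)·I_r` has no Gram factorisation of Johnson degree `≤ |A|/2`.)
[cite: LeeRaghavendraSteurer2015, Thm 1.12 (p. 8)] [cite: Grigoriev2001, Theorem (i) (PDF p. 6)] -/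
theorem not_isLowDegreeU_gram_interFallingQuadratic {n t k r m : ℕ} (ht : Odd t) (A : Finset (Fin n))
    (hA : A.card = 2 * k + 2) (hAt : 2 * k + 2 ≤ t) (hn : t + (2 * k + 2) ≤ n)
    (B : OddSet n → Matrix (Fin r) (Fin m) ℝ) (hB : IsLowDegreeU n (k + 1) B) (i : Fin r) :
    ¬ ∀ U : OddSet n, U.1.card = t →
        (((U.1 ∩ A).card : ℝ) - k) * (((U.1 ∩ A).card : ℝ) - k - 1) = (B U * (B U)ᵀ) i i := by
  classical
  intro hdiag
  refine not_sliceSos_interFallingQuadratic A hA hAt hn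
    ⟨m, fun j U => if hU : Odd U.card then B ⟨U, hU⟩ i j else 0,
      fun j => hB.hasDegreeLEOn_entry i j ht, fun U hU => ?_⟩
  have hUt : U.card = t := mem_powersetCard_univ.1 hU
  have hUodd : Odd U.card := hUt ▸ ht
  rw [hdiag ⟨U, hUodd⟩ hUt, Matrix.mul_apply]
  refine sum_congr rfl fun j _ => ?_
  show _ = (if hU : Odd U.card then B ⟨U, hU⟩ i j else 0) ^ 2
  rw [Matrix.transpose_apply, dif_pos hUodd, sq]

end CellVocabulary

/-! ## Part IV — The matching UPPER bounds: the cube and slice thresholds are exact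
(appended by the `pnp-psdrank` literature seat, g28, on top of `HypercubeSosUpperBounds.lean`:
Fawzi–Saunderson–Parrilo 2016 Thm 2 / the Sakaue–Takeda–Kim–Ito 2017 bound, proved there). -/

section UpperBounds

/-! ### IV.a — the cube: `f_k` is `(⌊m/2⌋ + 1)`-sos, so Grigoriev's window is sharp at the balanced point -/

/-- `f_k` has degree `≤ 2` (it is the quadratic `F_k` on the cube). [cite: LeePrakashDewolfYuen2016, §1.2] -/
theorem hasDegreeLE_fallingQuadratic (m k : ℕ) : HasDegreeLE 2 (fallingQuadratic m k) := by
  refine ⟨fallingPoly m k, ?_, eval_fallingPoly k⟩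
  have h1 : ((∑ i, X i : MvPolynomial (Fin m) ℝ) - C (k : ℝ)).totalDegree ≤ 1 := by
    refine (totalDegree_sub_C_le _ _).trans ((totalDegree_finsetSum _ _).trans (Finset.sup_le ?_))
    intro i _; exact (totalDegree_X (R := ℝ) i).le
  have h2 : ((∑ i, X i : MvPolynomial (Fin m) ℝ) - C ((k : ℝ) + 1)).totalDegree ≤ 1 := by
    refine (totalDegree_sub_C_le _ _).trans ((totalDegree_finsetSum _ _).trans (Finset.sup_le ?_))
    intro i _; exact (totalDegree_X (R := ℝ) i).le
  exact (totalDegree_mul _ _).trans (by omega)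

/-- **The knapsack quadratic is `(⌊m/2⌋ + 1)`-sos on `{0,1}^m`:** `f_k = Σ_i g_i²` on the cube with
`deg g_i ≤ m/2 + 1`, for every `k` — the Sakaue–Takeda–Kim–Ito bound `⌈(m+r−1)/2⌉` at `r = 2`
(`hasSosCertificate_of_nonneg_quadratic`).  With `not_hasSosCertificate_fallingQuadratic` the sos
degree of `f_k` on `{0,1}^m` is pinned for the balanced `k` (`m ∈ {2k+1, 2k+2}`), see the two `iff`s below.
[cite: KurpiszLeppanenMastrolilli2016, §1 (p. 3: the bound ⌈(n+r−1)/2⌉ and its tightness for f_1)] [cite: SakaueEtAl2017, main theorem (r = 2)] -/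
theorem hasSosCertificate_fallingQuadratic (m k : ℕ) :
    HasSosCertificate (2 * (m / 2 + 1)) (fallingQuadratic m k) :=
  hasSosCertificate_of_nonneg_quadratic _ (fallingQuadratic_nonneg k) (hasDegreeLE_fallingQuadratic m k)

/-- **Exact sos degree, even side of the balanced window:** on `{0,1}^{2k+2}` the function
`f_k = (|x| − k)(|x| − k − 1)` has a certificate of degree `d` (squares of degree `≤ d/2`) iff
`d ≥ 2k + 4`, i.e. `deg_sos(f_k) = 2(k + 2)`: Gram degree `k + 1` impossible (Grigoriev / LRS Thm 1.12),
`k + 2` possible (Sakaue–Takeda–Kim–Ito). [cite: KurpiszLeppanenMastrolilli2016, §1 (p. 3) and §3 (p. 6)] [cite: LeeRaghavendraSteurer2015, Thm 1.12 (p. 8)] -/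
theorem hasSosCertificate_fallingQuadratic_iff_even (k d : ℕ) :
    HasSosCertificate d (fallingQuadratic (2 * k + 2) k) ↔ 2 * k + 4 ≤ d := by
  constructor
  · intro h
    by_contra hd
    exact not_hasSosCertificate_fallingQuadratic (m := 2 * k + 2) le_rfl (by omega) h
  · intro hd
    obtain ⟨J, g, hg, hsq⟩ := hasSosCertificate_fallingQuadratic (2 * k + 2) k
    refine ⟨J, g, fun i => (hg i).mono ?_, hsq⟩
    have : 2 * ((2 * k + 2) / 2 + 1) / 2 = k + 2 := by omega
    rw [this]; omega

/-- **Exact sos degree, odd side (Lee–Raghavendra–Steurer's `f`, `m = 2k + 1 ≥ 3`):** on `{0,1}^{2k+1}`,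
`f_k` has a degree-`d` certificate iff `d ≥ 2k + 2`, i.e. `deg_sos(f_k) = m + 1` exactly — LRS
Thm 1.12's "`deg_sos(f) ≥ m + 1`" is an equality. [cite: LeeRaghavendraSteurer2015, Thm 1.12 (p. 8)] [cite: KurpiszLeppanenMastrolilli2016, §1 (p. 3: "the two upper bounds coincide when n is odd and r = 2")] -/
theorem hasSosCertificate_fallingQuadratic_iff_odd {k : ℕ} (hk : 1 ≤ k) (d : ℕ) :
    HasSosCertificate d (fallingQuadratic (2 * k + 1) k) ↔ 2 * k + 2 ≤ d := by
  constructor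
  · intro h
    by_contra hd
    exact not_hasSosCertificate_fallingQuadratic_of_window (m := 2 * k + 1) (by omega) (by omega)
      (by omega) (by omega) h
  · intro hd
    obtain ⟨J, g, hg, hsq⟩ := hasSosCertificate_fallingQuadratic (2 * k + 1) k
    refine ⟨J, g, fun i => (hg i).mono ?_, hsq⟩
    have : 2 * ((2 * k + 1) / 2 + 1) / 2 = k + 1 := by omega
    rw [this]; omega

/-- **Lee–Raghavendra–Steurer's Theorem 1.12 is tight:** for odd `m` the function
`f(x) = (m/2 − Σ_i x_i)² − 1/4` on `{0,1}^m` HAS a certificate of degree `m + 1` (squares of degree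
`(m+1)/2 = ⌈m/2⌉`), complementing `LeeRaghavendraSteurer2015_thm112` (`deg_sos(f) ≥ m + 1`).
[cite: LeeRaghavendraSteurer2015, Thm 1.12 (p. 8)] [cite: KurpiszLeppanenMastrolilli2016, §1 (p. 3)] -/
theorem LeeRaghavendraSteurer2015_thm112_tight (hodd : Odd m) :
    HasSosCertificate (m + 1)
      (fun x : Fin m → Bool => ((m : ℝ) / 2 - ∑ i, cubePoint x i) ^ 2 - 1 / 4) := by
  obtain ⟨k, rfl⟩ := hodd
  have hf : (fun x : Fin (2 * k + 1) → Bool =>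
      (((2 * k + 1 : ℕ) : ℝ) / 2 - ∑ i, cubePoint x i) ^ 2 - 1 / 4) = fallingQuadratic (2 * k + 1) k := by
    funext x
    simp only [fallingQuadratic]
    push_cast
    ring
  rw [hf]
  have h := hasSosCertificate_fallingQuadratic (2 * k + 1) k
  have : 2 * ((2 * k + 1) / 2 + 1) = 2 * k + 1 + 1 := by omega
  rwa [this] at h

/-! ### IV.b — the slice: `g_{A,k}` IS a sum of squares of Johnson degree `⌊|A|/2⌋ + 1` -/

variable {n : ℕ}

/-- The restriction of a set `U ⊆ [n]` to the coordinates of `A` (enumerated increasingly),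
`z_A(U)_i = [a_i ∈ U]`, has `|z_A(U)| = |U ∩ A|`. [cite: FilmusIhringer2019, §2 (p. 4: restriction x|_I)] -/
theorem card_trueSet_restrictToCoords (A U : Finset (Fin n)) :
    (trueSet (fun i : Fin A.card => decide (A.orderEmbOfFin rfl i ∈ U))).card = (U ∩ A).card := by
  classical
  set a := A.orderEmbOfFin rfl with ha
  have hinj : Function.Injective a := a.injective
  rw [← card_image_of_injective _ hinj]
  congr 1
  ext p
  simp only [mem_image, mem_trueSet, decide_eq_true_eq, mem_inter]
  constructor
  · rintro ⟨i, hi, rfl⟩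
    exact ⟨hi, by rw [ha]; exact Finset.orderEmbOfFin_mem A rfl i⟩
  · rintro ⟨hpU, hpA⟩
    have : p ∈ Set.range a := by rw [ha, Finset.range_orderEmbOfFin]; exact hpA
    obtain ⟨i, rfl⟩ := this
    exact ⟨i, hpU, rfl⟩

/-- `g_{A,k}(U) = f_k(z_A(U))`. [cite: LeePrakashDewolfYuen2016, §1.2] -/
theorem fallingQuadratic_restrictToCoords (A U : Finset (Fin n)) (k : ℕ) :
    fallingQuadratic A.card k (fun i : Fin A.card => decide (A.orderEmbOfFin rfl i ∈ U)) =
      (((U ∩ A).card : ℝ) - k) * (((U ∩ A).card : ℝ) - k - 1) := by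
  rw [fallingQuadratic_eq_card, card_trueSet_restrictToCoords]

/-- **Pull-back of cube degree to slice degree.**  If `q : {0,1}^{|A|} → ℝ` has degree `≤ l`
(agrees with a polynomial `P` of total degree `≤ l`), then `U ↦ q(z_A(U))` has Johnson degree `≤ l` on
any domain `𝒟` in Filmus's sense: on `0/1` points each monomial `∏_{i ∈ supp α} x_i^{α_i}` of `P` reads
`1[a(supp α) ⊆ U]`, a containment indicator of a set of size `|supp α| ≤ deg α ≤ l`.
[cite: FilmusIhringer2019, §2 (p. 4: "degree ≤ d: f = Σ_{|S| ≤ d} c_S x_S on the domain")] -/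
theorem hasDegreeLEOn_comp_restrictToCoords (A : Finset (Fin n)) {l : ℕ} {q : (Fin A.card → Bool) → ℝ}
    (hq : HasDegreeLE l q) (𝒟 : Finset (Finset (Fin n))) :
    SliceFKN.HasDegreeLEOn 𝒟 l (fun U => q (fun i : Fin A.card => decide (A.orderEmbOfFin rfl i ∈ U))) := by
  classical
  obtain ⟨P, hP, hPq⟩ := hq
  set a := A.orderEmbOfFin rfl with ha
  -- coefficient vector: `v_T = Σ_{α : a(supp α) = T} coeff α`
  let v : Finset (Fin n) → ℝ := fun T =>
    ∑ α ∈ P.support, if (α.support).image a = T then P.coeff α else 0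
  have hsupp : ∀ α ∈ P.support, ((α.support).image a).card ≤ l := by
    intro α hα
    rw [card_image_of_injective _ a.injective]
    refine le_trans ?_ ((MvPolynomial.le_totalDegree hα).trans hP)
    rw [Finsupp.sum, Finset.card_eq_sum_ones]
    exact sum_le_sum fun i hi => Nat.one_le_iff_ne_zero.2 (Finsupp.mem_support_iff.1 hi)
  refine ⟨v, fun T hT => ?_, fun U _ => ?_⟩
  · refine sum_eq_zero fun α hα => ?_
    rw [if_neg]
    rintro rfl
    exact absurd (hsupp α hα) (not_le.2 hT)
  · -- evaluate the polynomial on the 0/1 point `z_A(U)`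
    show q _ = _
    rw [← hPq, MvPolynomial.eval_eq, JohnsonHarmonics.zeta_apply]
    -- right-hand side: `Σ_{T ⊆ U} v_T = Σ_α coeff α · 1[a(supp α) ⊆ U]`
    have hR : ∑ T ∈ U.powerset, v T = ∑ α ∈ P.support, if (α.support).image a ⊆ U then P.coeff α else 0 := by
      simp only [v]
      rw [sum_comm]
      refine sum_congr rfl fun α _ => ?_
      rw [← sum_filter, Finset.filter_eq]
      by_cases h : (α.support).image a ⊆ U
      · rw [if_pos (mem_powerset.2 h), if_pos h, sum_singleton]
      · rw [if_neg (fun h' => h (mem_powerset.1 h')), if_neg h, sum_empty]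
    rw [hR]
    refine sum_congr rfl fun α _ => ?_
    -- the monomial on a 0/1 point
    have hmono : ∏ i ∈ α.support, cubePoint (fun i : Fin A.card => decide (a i ∈ U)) i ^ α i =
        if (α.support).image a ⊆ U then (1 : ℝ) else 0 := by
      split_ifs with h
      · refine prod_eq_one fun i hi => ?_
        have hiU : a i ∈ U := h (mem_image_of_mem a hi)
        rw [cubePoint_of_eq_true (by simpa using hiU), one_pow]
      · obtain ⟨p, hp, hpU⟩ := not_subset.1 h
        obtain ⟨i, hi, rfl⟩ := mem_image.1 hp
        refine prod_eq_zero hi ?_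
        rw [cubePoint_of_eq_false (by simpa using hpU), zero_pow (Finsupp.mem_support_iff.1 hi)]
    rw [hmono]
    split_ifs <;> simp

/-- **The slice upper bound: `g_{A,k}` is a sum of squares of Johnson degree `⌊|A|/2⌋ + 1`.**  For
every `A ⊆ [n]`, `k`, and every domain `𝒟` of subsets (e.g. the slice `C([n],t) = univ.powersetCard t`):
`g_{A,k}(U) = (|U ∩ A| − k)(|U ∩ A| − k − 1) = Σ_j h_j(U)²` on `𝒟` with all `h_j` of Johnson degree
`≤ |A|/2 + 1` on `𝒟` — the cube certificate of `f_k` on `{0,1}^{|A|}` (`hasSosCertificate_fallingQuadratic`,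
Sakaue–Takeda–Kim–Ito at `r = 2`) pulled back along `U ↦ z_A(U)`.  With
`not_sliceSos_interFallingQuadratic` (`|A| = 2k + 2 ≤ t ≤ n − 2k − 2`: degree `k + 1` impossible) the
Johnson-degree threshold of `g_{A,k}` on `C([n],t)` is EXACTLY `⌊|A|/2⌋ + 1` (`…_iff` below).
[cite: KurpiszLeppanenMastrolilli2016, §1 (p. 3)] [cite: SakaueEtAl2017, main theorem (r = 2)] [cite: FilmusIhringer2019, §2 (p. 4: degree on a domain)] -/
theorem sliceSos_interFallingQuadratic (A : Finset (Fin n)) (k : ℕ) (𝒟 : Finset (Finset (Fin n))) :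
    ∃ (J : ℕ) (h : Fin J → Finset (Fin n) → ℝ),
      (∀ j, SliceFKN.HasDegreeLEOn 𝒟 (A.card / 2 + 1) (h j)) ∧
      ∀ U ∈ 𝒟, (((U ∩ A).card : ℝ) - k) * (((U ∩ A).card : ℝ) - k - 1) = ∑ j, h j U ^ 2 := by
  obtain ⟨J, g, hg, hsq⟩ := hasSosCertificate_fallingQuadratic A.card k
  refine ⟨J, fun j U => g j (fun i : Fin A.card => decide (A.orderEmbOfFin rfl i ∈ U)),
    fun j => hasDegreeLEOn_comp_restrictToCoords A ?_ 𝒟, fun U _ => ?_⟩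
  · have : 2 * (A.card / 2 + 1) / 2 = A.card / 2 + 1 := by omega
    simpa [this] using hg j
  · rw [← fallingQuadratic_restrictToCoords A U k, hsq]

/-- **Exact Johnson-degree threshold on the slice (even `|A|`).**  For `|A| = 2k + 2 ≤ t ≤ n − 2k − 2`,
`g_{A,k}` is a sum of squares of functions of Johnson degree `≤ l` on `C([n],t)` iff `l ≥ k + 2 = |A|/2 + 1`.
[cite: LeeRaghavendraSteurer2015, Thm 1.12 (p. 8)] [cite: KurpiszLeppanenMastrolilli2016, §1 (p. 3)] [cite: FilmusIhringer2019, §2 (p. 4)] -/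
theorem sliceSos_interFallingQuadratic_iff {t k l : ℕ} (A : Finset (Fin n)) (hA : A.card = 2 * k + 2)
    (hAt : 2 * k + 2 ≤ t) (hn : t + (2 * k + 2) ≤ n) :
    (∃ (J : ℕ) (h : Fin J → Finset (Fin n) → ℝ),
        (∀ j, SliceFKN.HasDegreeLEOn (univ.powersetCard t) l (h j)) ∧
        ∀ U ∈ univ.powersetCard t,
          (((U ∩ A).card : ℝ) - k) * (((U ∩ A).card : ℝ) - k - 1) = ∑ j, h j U ^ 2) ↔ k + 2 ≤ l := by
  constructor
  · rintro ⟨J, h, hdeg, hsq⟩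
    by_contra hl
    refine not_sliceSos_interFallingQuadratic A hA hAt hn ⟨J, h, fun j => ?_, hsq⟩
    obtain ⟨v, hv, hvh⟩ := hdeg j
    exact ⟨v, fun S hS => hv S (by omega), hvh⟩
  · intro hl
    obtain ⟨J, h, hdeg, hsq⟩ := sliceSos_interFallingQuadratic A k (univ.powersetCard t)
    refine ⟨J, h, fun j => ?_, hsq⟩
    obtain ⟨v, hv, hvh⟩ := hdeg j
    exact ⟨v, fun S hS => hv S (by omega), hvh⟩

end UpperBounds

/-! ### IV.c — the cell's currency: a Gram factor of Johnson degree `⌊|A|/2⌋ + 1` for `g_{A,k} · I₁` -/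

section CellVocabularyUpper

open Matrix
open Literature.Barriers.PneNP (OddSet)

variable {n : ℕ}

/-- **The scalar field `g_{A,k}` HAS a low-degree Gram factorisation at degree `⌊|A|/2⌋ + 1`** (the
converse side of `not_isLowDegreeU_gram_interFallingQuadratic`): there is a row-vector field
`B : OddSet n → ℝ^{1 × J}` with `IsLowDegreeU n (|A|/2 + 1) B` and `(B_U B_Uᵀ)_{00} = g_{A,k}(U)` for
EVERY odd cut `U` (all sizes at once).  So in the bricks' vocabulary the Johnson-degree threshold for
Gram factors of `g_{A,k} · I` is exactly `|A|/2 + 1` when `|A| = 2k + 2 ≤ t ≤ n − 2k − 2`.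
[cite: LeeRaghavendraSteurer2015, §5 (matrix-valued low-degree functions) and Thm 1.12 (p. 8)] [cite: KurpiszLeppanenMastrolilli2016, §1 (p. 3)] [cite: SakaueEtAl2017, main theorem (r = 2)] -/
theorem isLowDegreeU_gram_interFallingQuadratic (A : Finset (Fin n)) (k : ℕ) :
    ∃ (J : ℕ) (B : OddSet n → Matrix (Fin 1) (Fin J) ℝ), IsLowDegreeU n (A.card / 2 + 1) B ∧
      ∀ U : OddSet n,
        (((U.1 ∩ A).card : ℝ) - k) * (((U.1 ∩ A).card : ℝ) - k - 1) = (B U * (B U)ᵀ) 0 0 := by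
  classical
  obtain ⟨J, h, hdeg, hsq⟩ := sliceSos_interFallingQuadratic A k (univ : Finset (Finset (Fin n)))
  refine ⟨J, fun U => Matrix.of fun _ j => h j U.1, fun i j => ?_, fun U => ?_⟩
  · obtain ⟨v, hv, hvh⟩ := hdeg j
    have hfun : (fun U : OddSet n => (Matrix.of fun (_ : Fin 1) j => h j U.1) i j) =
        ∑ T ∈ univ.filter (fun T : Finset (Fin n) => T.card ≤ A.card / 2 + 1),
          v T • (fun U : OddSet n => if T ⊆ U.1 then (1 : ℝ) else 0) := by
      funext U
      rw [Matrix.of_apply, hvh U.1 (mem_univ _), JohnsonHarmonics.zeta_apply, Finset.sum_apply]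
      simp only [Pi.smul_apply, smul_eq_mul, mul_ite, mul_one, mul_zero]
      rw [← sum_filter]
      calc ∑ T ∈ U.1.powerset, v T
          = ∑ T ∈ U.1.powerset.filter (fun T => T.card ≤ A.card / 2 + 1), v T := by
            rw [← sum_filter_add_sum_filter_not U.1.powerset (fun T => T.card ≤ A.card / 2 + 1),
              add_eq_left]
            exact sum_eq_zero fun T hT => hv T (not_le.1 (mem_filter.1 hT).2)
        _ = _ := by
            congr 1
            ext T
            simp [mem_powerset, and_comm]
    rw [hfun]
    refine Submodule.sum_mem _ fun T hT => Submodule.smul_mem _ _ (Submodule.subset_span ?_)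
    exact ⟨⟨T, (mem_filter.1 hT).2⟩, rfl⟩
  · rw [hsq U.1 (mem_univ _), Matrix.mul_apply]
    refine sum_congr rfl fun j _ => ?_
    simp only [Matrix.transpose_apply, Matrix.of_apply, sq]

end CellVocabularyUpper

end Literature.Combinatorics.Optimization

end
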